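import Summits.BirchSwinnertonDyer.BirchSwinnertonDyer.Theorems.EdixhovenFibreFiveSevenStarredOptimalManinUnitFiveSevenTransportedHodgeLine
import Literature.NumberTheory.PAdicHodge.AinfRamifiedHodgeLineEvaluation
import HarnessLib

/-!
# (HL-eval) for the K★ cells with NO Hodge-line hypothesis: for `W_D ≡ E₀ (mod ϖ)` over `𝒪_D = ℤ_p[ϖ]` (`p` odd, `E₀` with elliptic fibres)
# there are `A, B ∈ ℚ_p(ϖ)` such that EVERY `[p]_{W_D}`-division tower `u` of `Ŵ_D(𝔪_{ℂ_F})` with CM-fibre transport `w` satisfies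
# `log_{W_D}(u₀) = A·log_{E₀}(w₀) + B·𝒞_w(log_{E₀}(Xᵖ))`, and `= 0` on the Tate module

Cell `pub/bsd-wall`, D-0145 line `route-BirchSwinnertonDyer-EdixhovenFibreFiveSeven`, seat `bsd-line-edix-p1` (gen 27); crux K★
`stmt-BirchSwinnertonDyer-22226` (`StarredOptimalManinUnitFiveSeven`), line `kato_lever`, memo `Cruxes/StarredOptimalManinUnitFiveSeven/Lines/
kato-lever-K2-ramified-cm-transport.md` §9 (HL-eval). THEOREMS ONLY (no definition, no named fact, no instance, no `sorry`); helper
`--supports stmt-BirchSwinnertonDyer-22226`. **BSD is not proved by this file, and neither is K★**: it is a statement about formal groups over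
`ℤ_p[ϖ]` and their `𝔪_{ℂ_F}`-points.

THE STATEMENTS. `exists_hodgeLine_eval`: composition of the landed Hodge line (`TransportedHodgeLine.exists_transportedHodgeLine`, p768226:
`log_{W_D} ≡ A·log_{E₀} + B·log_{E₀}(Xᵖ)` modulo `p^{−d}`-bounded, `A = Σ aᵢϖⁱ`, `B = Σ bᵢϖⁱ`, `aᵢ, bᵢ ∈ ℚ_p`) with the analytic evaluation
along division towers (`AinfRamTop.tsum_formalLog_eq_hodgeLine_eval`, p769861; J1–J4 of the memo): the pair `(A, B)` depends on `W_D, E₀` only,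
and for every exact `[p]_{W_D}`-tower `u` and every exact `[p]_{E₀}`-tower `w` with `‖wₙ − uₙ‖ ≤ ‖ϖ‖` (the CM-fibre transport `Tu` of p766713):
`log_{W_D}(u₀) = A·log_{E₀}(w₀) + B·𝒞` where `𝒞 = lim pⁿ·log_{E₀}(wₙᵖ)` (the Colmez functional of `log_{E₀}(Xᵖ)` along `w`).
`hodgeLine_eval_eq_zero_of_torsion`: on TORSION towers (`u₀ = 0`, i.e. `u ∈ T_pŴ_D`) the right side vanishes — the Hodge combination
`A·P⁰ + B·Q⁰` of the transported crystalline periods is `Fil¹`-valued on the Tate module (note `w₀ = (Tu)₀ ≠ 0` in general).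
What remains for (K₂)@cells (T2): the `B_max⁺`-side identities `θ(f Λ_N(ι[w̃])) = p^N·log_{E₀}(w₀)` and `θ(f φΛ_N(ι[w̃])) = p^N·𝒞`.

References: [cite: Katz1981CrystallineDieudonne, §5.1, Thm. 5.1.4, Thm. 5.3.3] · [cite: Colmez1992PeriodesAbeliennes, §2] · [cite: SilvermanAEC2009, Thm. IV.6.4].
-/

set_option autoImplicit false
-- single-conjunct summit: `Summit.BirchSwinnertonDyer.BirchSwinnertonDyer.…` repeats the name by design
set_option linter.dupNamespace false

noncomputable section

open scoped Classical Topology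
open Filter ValuativeRel Field Literature.NumberTheory.PAdicHodge
  Literature.NumberTheory.GaloisRepresentations Literature.NumberTheory.GaloisRepresentations.IsNonarchimedeanLocalField
  Literature.NumberTheory.GaloisRepresentations.LubinTate

namespace Summit.BirchSwinnertonDyer.BirchSwinnertonDyer.Theorems.TransportedHodgeLine

variable {F : Type} [Field F] [ValuativeRel F] [TopologicalSpace F] [IsNonarchimedeanLocalField F] [CharZero F]
  {p : ℕ} [hpp : Fact p.Prime] {hp : valuation F p < 1} (D : EisensteinRoot F p hp) [CharZero (CompletedAlgClosure F)]
  [Fact (¬ IsUnit (p : integerC F))]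

/-- ★★★ **(HL-eval) for a ramified good model congruent to a `ℤ`-curve.** For `W/𝒪_D` with `W ≡ E₀ (mod ϖ)`, `E₀/ℤ` with elliptic fibres over
`ℚ_p` and `𝔽_p`, `p ≠ 2`, `‖ϖ‖ʲ ≤ M‖j‖`: there are `aᵢ, bᵢ ∈ ℚ_p` (`i < e`), giving `A = Σ aᵢϖⁱ`, `B = Σ bᵢϖⁱ ∈ ℂ_F`, such that for EVERY exact
`[p]_{W_D}`-division tower `u` of `Ŵ_D(𝔪_{ℂ_F})` and every exact `[p]_{E₀}`-division tower `w` with `‖wₙ − uₙ‖ ≤ ‖ϖ‖` there is `𝒞 ∈ ℂ_F` with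
`pⁿ·log_{E₀}(Xᵖ)(wₙ) → 𝒞` and **`log_{W_D}(u₀) = A·log_{E₀}(w₀) + B·𝒞`** (values `G(x) = Σ' [Xʲ]G·xʲ`).
[cite: Katz1981CrystallineDieudonne, Thm. 5.1.4, Thm. 5.3.3] [cite: Colmez1992PeriodesAbeliennes, §2] -/
theorem exists_hodgeLine_eval (hp2 : p ≠ 2) (W : WeierstrassCurve (EisensteinRoot.CoeffDisc D)) (E₀ : WeierstrassCurve ℤ)
    [((E₀.map (Int.castRingHom ℤ_[p])).map PadicInt.Coe.ringHom).IsElliptic]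
    [((E₀.map (Int.castRingHom ℤ_[p])).map PadicInt.toZMod).IsElliptic]
    (hWE : W.map (Ideal.Quotient.mk (Ideal.span {EisensteinRoot.CoeffDisc.of D (AdjoinRoot.root D.poly)})) =
      (E₀.map (algebraMap ℤ (EisensteinRoot.CoeffDisc D))).map
        (Ideal.Quotient.mk (Ideal.span {EisensteinRoot.CoeffDisc.of D (AdjoinRoot.root D.poly)})))
    {M : ℝ} (hM0 : 0 ≤ M) (hM : ∀ j : ℕ, 1 ≤ j → ‖((D.rootC : integerC F) : CompletedAlgClosure F)‖ ^ j ≤ M * ‖(j : CompletedAlgClosure F)‖) :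
    ∃ (a b : Fin D.e → PadicBase F p hp), ∀ (u w : ℕ → (maxNilIdealC F).toIdeal),
      (∀ n, AinfRamTop.mulPC (D := D) W (u (n + 1)) = u n) → (∀ n, AinfTop.mulPC F p E₀ (w (n + 1)) = w n) →
      (∀ n, ‖(((w n : (maxNilIdealC F).toIdeal) : CBall F) : CompletedAlgClosure F) -
        (((u n : (maxNilIdealC F).toIdeal) : CBall F) : CompletedAlgClosure F)‖ ≤ ‖((D.rootC : integerC F) : CompletedAlgClosure F)‖) →
      ∃ 𝒞 : CompletedAlgClosure F,
        Tendsto (fun m : ℕ => (p : CompletedAlgClosure F) ^ m *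
          ∑' j : ℕ, PowerSeries.coeff j (PowerSeries.expand p hpp.out.ne_zero (E₀.map (Int.castRingHom (CompletedAlgClosure F))).formalLog) *
            (((w m : (maxNilIdealC F).toIdeal) : CBall F) : CompletedAlgClosure F) ^ j) atTop (𝓝 𝒞) ∧
        ∑' j : ℕ, PowerSeries.coeff j (W.map ((CBall F).subtype.comp (EisensteinRoot.CoeffDisc.toCBall D))).formalLog *
            (((u 0 : (maxNilIdealC F).toIdeal) : CBall F) : CompletedAlgClosure F) ^ j =
          (∑ i : Fin D.e, algebraMap F (CompletedAlgClosure F) (algebraMap (PadicBase F p hp) F (a i)) *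
              ((D.rootC : integerC F) : CompletedAlgClosure F) ^ (i : ℕ)) *
            ∑' j : ℕ, PowerSeries.coeff j (E₀.map (Int.castRingHom (CompletedAlgClosure F))).formalLog *
              (((w 0 : (maxNilIdealC F).toIdeal) : CBall F) : CompletedAlgClosure F) ^ j +
          (∑ i : Fin D.e, algebraMap F (CompletedAlgClosure F) (algebraMap (PadicBase F p hp) F (b i)) *
              ((D.rootC : integerC F) : CompletedAlgClosure F) ^ (i : ℕ)) * 𝒞 := by
  obtain ⟨a, b, d, hHL⟩ := exists_transportedHodgeLine D hp2 W E₀ hWE hM0 hM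
  refine ⟨a, b, fun u w hu hw hwu => ?_⟩
  obtain ⟨𝒞, h𝒞, -, heval⟩ := AinfRamTop.tsum_formalLog_eq_hodgeLine_eval D W E₀ _ _ d hHL u w hu hw hwu
  exact ⟨𝒞, h𝒞, heval⟩

/-- ★★ **(HL-eval) on the Tate module.** In the situation of `exists_hodgeLine_eval`, with THE SAME `aᵢ, bᵢ`: for every `[p]_{W_D}`-division tower `u`
of the origin (`u₀ = 0`, an element of `T_pŴ_D`) and every exact `[p]_{E₀}`-tower `w` with `‖wₙ − uₙ‖ ≤ ‖ϖ‖`, **`A·log_{E₀}(w₀) + B·𝒞 = 0`** — the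
Hodge combination of the transported period functionals is `Fil¹`-valued on the Tate module; and the rational-point reading of
`exists_hodgeLine_eval` holds simultaneously. [cite: Katz1981CrystallineDieudonne, Thm. 5.1.4, Thm. 5.3.3] [cite: Colmez1992PeriodesAbeliennes, §2] -/
theorem exists_hodgeLine_eval_and_torsion (hp2 : p ≠ 2) (W : WeierstrassCurve (EisensteinRoot.CoeffDisc D)) (E₀ : WeierstrassCurve ℤ)
    [((E₀.map (Int.castRingHom ℤ_[p])).map PadicInt.Coe.ringHom).IsElliptic]
    [((E₀.map (Int.castRingHom ℤ_[p])).map PadicInt.toZMod).IsElliptic]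
    (hWE : W.map (Ideal.Quotient.mk (Ideal.span {EisensteinRoot.CoeffDisc.of D (AdjoinRoot.root D.poly)})) =
      (E₀.map (algebraMap ℤ (EisensteinRoot.CoeffDisc D))).map
        (Ideal.Quotient.mk (Ideal.span {EisensteinRoot.CoeffDisc.of D (AdjoinRoot.root D.poly)})))
    {M : ℝ} (hM0 : 0 ≤ M) (hM : ∀ j : ℕ, 1 ≤ j → ‖((D.rootC : integerC F) : CompletedAlgClosure F)‖ ^ j ≤ M * ‖(j : CompletedAlgClosure F)‖) :
    ∃ (a b : Fin D.e → PadicBase F p hp),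
      (∀ (u w : ℕ → (maxNilIdealC F).toIdeal),
        (∀ n, AinfRamTop.mulPC (D := D) W (u (n + 1)) = u n) → (∀ n, AinfTop.mulPC F p E₀ (w (n + 1)) = w n) →
        (∀ n, ‖(((w n : (maxNilIdealC F).toIdeal) : CBall F) : CompletedAlgClosure F) -
          (((u n : (maxNilIdealC F).toIdeal) : CBall F) : CompletedAlgClosure F)‖ ≤ ‖((D.rootC : integerC F) : CompletedAlgClosure F)‖) →
        ∃ 𝒞 : CompletedAlgClosure F,
          Tendsto (fun m : ℕ => (p : CompletedAlgClosure F) ^ m *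
            ∑' j : ℕ, PowerSeries.coeff j (PowerSeries.expand p hpp.out.ne_zero (E₀.map (Int.castRingHom (CompletedAlgClosure F))).formalLog) *
              (((w m : (maxNilIdealC F).toIdeal) : CBall F) : CompletedAlgClosure F) ^ j) atTop (𝓝 𝒞) ∧
          ∑' j : ℕ, PowerSeries.coeff j (W.map ((CBall F).subtype.comp (EisensteinRoot.CoeffDisc.toCBall D))).formalLog *
              (((u 0 : (maxNilIdealC F).toIdeal) : CBall F) : CompletedAlgClosure F) ^ j =
            (∑ i : Fin D.e, algebraMap F (CompletedAlgClosure F) (algebraMap (PadicBase F p hp) F (a i)) *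
                ((D.rootC : integerC F) : CompletedAlgClosure F) ^ (i : ℕ)) *
              ∑' j : ℕ, PowerSeries.coeff j (E₀.map (Int.castRingHom (CompletedAlgClosure F))).formalLog *
                (((w 0 : (maxNilIdealC F).toIdeal) : CBall F) : CompletedAlgClosure F) ^ j +
            (∑ i : Fin D.e, algebraMap F (CompletedAlgClosure F) (algebraMap (PadicBase F p hp) F (b i)) *
                ((D.rootC : integerC F) : CompletedAlgClosure F) ^ (i : ℕ)) * 𝒞) ∧
      (∀ (u w : ℕ → (maxNilIdealC F).toIdeal),
        (∀ n, AinfRamTop.mulPC (D := D) W (u (n + 1)) = u n) → (((u 0 : (maxNilIdealC F).toIdeal) : CBall F) : CompletedAlgClosure F) = 0 →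
        (∀ n, AinfTop.mulPC F p E₀ (w (n + 1)) = w n) →
        (∀ n, ‖(((w n : (maxNilIdealC F).toIdeal) : CBall F) : CompletedAlgClosure F) -
          (((u n : (maxNilIdealC F).toIdeal) : CBall F) : CompletedAlgClosure F)‖ ≤ ‖((D.rootC : integerC F) : CompletedAlgClosure F)‖) →
        ∃ 𝒞 : CompletedAlgClosure F,
          Tendsto (fun m : ℕ => (p : CompletedAlgClosure F) ^ m *
            ∑' j : ℕ, PowerSeries.coeff j (PowerSeries.expand p hpp.out.ne_zero (E₀.map (Int.castRingHom (CompletedAlgClosure F))).formalLog) *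
              (((w m : (maxNilIdealC F).toIdeal) : CBall F) : CompletedAlgClosure F) ^ j) atTop (𝓝 𝒞) ∧
          (∑ i : Fin D.e, algebraMap F (CompletedAlgClosure F) (algebraMap (PadicBase F p hp) F (a i)) *
                ((D.rootC : integerC F) : CompletedAlgClosure F) ^ (i : ℕ)) *
              ∑' j : ℕ, PowerSeries.coeff j (E₀.map (Int.castRingHom (CompletedAlgClosure F))).formalLog *
                (((w 0 : (maxNilIdealC F).toIdeal) : CBall F) : CompletedAlgClosure F) ^ j +
            (∑ i : Fin D.e, algebraMap F (CompletedAlgClosure F) (algebraMap (PadicBase F p hp) F (b i)) *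
                ((D.rootC : integerC F) : CompletedAlgClosure F) ^ (i : ℕ)) * 𝒞 = 0) := by
  obtain ⟨a, b, d, hHL⟩ := exists_transportedHodgeLine D hp2 W E₀ hWE hM0 hM
  refine ⟨a, b, fun u w hu hw hwu => ?_, fun u w hu hu0 hw hwu => ?_⟩
  · obtain ⟨𝒞, h𝒞, -, heval⟩ := AinfRamTop.tsum_formalLog_eq_hodgeLine_eval D W E₀ _ _ d hHL u w hu hw hwu
    exact ⟨𝒞, h𝒞, heval⟩
  · exact AinfRamTop.hodgeLine_eval_eq_zero_of_torsion D W E₀ _ _ d hHL u w hu hu0 hw hwu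

end Summit.BirchSwinnertonDyer.BirchSwinnertonDyer.Theorems.TransportedHodgeLine
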